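import Summits.CriticalPhenomena.SAWScalingLimit.Theses.SAWMassiveIsingTilt
import Summits.CriticalPhenomena.SAWScalingLimit.Theorems.SAWMassiveIsingTiltDefs
import Literature.Probability.RandomPlanarGeometry.ConformalRestrictionHolds
import Literature.Probability.RandomPlanarGeometry.ConformalRestrictionLocal
import Literature.Probability.RandomPlanarGeometry.HullRestrictionSLEHolds
import Literature.Probability.RandomPlanarGeometry.CritPercSLESimplePathHolds
import Literature.Probability.RandomPlanarGeometry.SLEExistenceNeEightHolds
import Mathlib.MeasureTheory.Measure.Portmanteau
import HarnessLib

/-!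
# Crux `MassiveWindowSLE` (stmt-CriticalPhenomena-7685), line `registered` (skeleton r5):
stub `stub_noTouchOfNearTouchEstimate` — the near-touch estimate passes to the window limit

Route `SAWMassiveIsingTilt` of `CriticalPhenomena/SAWScalingLimit`; stub 3b (passage glue) of the
line `registered` (skeleton `Cruxes/MassiveWindowSLE/Lines/birth.lean`, r5). Objects: the named
tilted interface law `tiltLaw` of `Theorems/SAWMassiveIsingTiltDefs.lean` and the window laws
`tiltLaw D.carrier δ (x δ) (1/√3 − m δ·δ) (a δ) (b δ)` pushed to `CurveClass ℂ` by `γ ↦ γ.curve`.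

Statement (`stub_noTouchOfNearTouchEstimate`, the registered signature verbatim): given common
endpoint approximations of hull pairs, a fast window schedule `m` and tilt `x` whose window laws
converge in law (`TendstoLaw`) to `P D` in every Dobrushin domain `D`, `P` chordal, and the lattice
NEAR-TOUCH ESTIMATE (stub 3a: for every hull pair `D' ⊆ D`, endpoint approximation and `η > 0`
there is `ε > 0` with `ν_δ (G_ε) ≤ η` for all small `δ`, where
`G_ε = {γ | (∀ z ∈ range γ, infDist z (cl D') < ε) ∧ ∃ z ∈ range γ, ∃ k ∈ cl (D ∖ D'), d(z, k) < ε}`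
is the near-touch event), the window limit does NOT TOUCH inner hulls:
`P D {γ | range γ ⊆ cl D' ∧ (range γ ∩ cl (D ∖ D')).Nonempty} = 0`.

Proof (pure measure theory / topology on the curve space):
* the NoTouch event lies in every `G_ε` (`infDist z (cl D') = 0`, `dist z z = 0`);
* `G_ε` is OPEN (`ntb_isOpen_nearTouch`): every point of the trace of a curve class is within
  `dist c₁ c₂` of the trace of the other (`Curve.infDist_range_le`), and the supremum of
  `infDist · (cl D')` over the compact nonempty trace is attained;
* the window laws are probability measures for small `δ` (`tiltLaw` is a probability measure or
  `0`, and the test integral of `f ≡ 1` tends to `1`);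
* portmanteau along the filter `𝓝[>] 0` (`ProbabilityMeasure.le_liminf_measure_open_of_tendsto`,
  after modifying the push-forwards into probability measures off the good set):
  `P D (NoTouch) ≤ P D (G_ε) ≤ liminf_δ ν_δ (G_ε) ≤ η` for every `η > 0`.

References: P. Billingsley, *Convergence of probability measures*, 2nd ed., Thm 2.1
(portmanteau); G. F. Lawler, O. Schramm, W. Werner, *Conformal restriction: the chordal case*,
J. Amer. Math. Soc. 16 (2003) (hull subdomains). No named fact is used; axioms `propext`,
`Classical.choice`, `Quot.sound`.
-/

noncomputable section

namespace Summit.CriticalPhenomena.SAWScalingLimit.Theorems.MassiveWindowSLE.Birth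

open scoped Topology NNReal ENNReal BoundedContinuousFunction
open Filter Set MeasureTheory Metric
open Literature.Probability Literature.Probability.LatticeModels
  Literature.Probability.RandomPlanarGeometry
open Summit.CriticalPhenomena.SAWScalingLimit.Theorems.SAWMassiveIsingTilt (tilt tiltLaw)

/-! ### The tilted interface law is a probability measure or zero -/

/-- Dichotomy: `tiltLaw` is a probability measure or the zero measure (its total mass
`Z⁻¹ · Z` is `1`, or `0` in the junk regimes `Z = 0`, `Z = ∞`). -/
theorem ntb_isProbabilityMeasure_tiltLaw_or_eq_zero (Ω : Set ℂ) (δ x y : ℝ) (a b : HexVertex) :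
    IsProbabilityMeasure (tiltLaw Ω δ x y a b) ∨ tiltLaw Ω δ x y a b = 0 := by
  -- adapted from `Theorems/SubseqIdentification/Negative/Necessity.lean`,
  -- `isProbabilityMeasure_law_or_eq_zero`
  have hmass : tiltLaw Ω δ x y a b univ = 0 ∨ tiltLaw Ω δ x y a b univ = 1 := by
    rw [tiltLaw, Measure.smul_apply, smul_eq_mul]
    rcases eq_or_ne (tilt Ω δ x y a b univ) 0 with h0 | h0
    · left; rw [h0, mul_zero]
    rcases eq_or_ne (tilt Ω δ x y a b univ) ⊤ with ht | ht
    · left; rw [ht, ENNReal.inv_top, zero_mul]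
    · right; exact ENNReal.inv_mul_cancel h0 ht
  rcases hmass with h | h
  · exact Or.inr (Measure.measure_univ_eq_zero.1 h)
  · exact Or.inl ⟨h⟩

/-! ### Abstract passage lemmas along `𝓝[>] 0` -/

/-- If laws that are each a probability measure or zero converge in law (`TendstoLaw`) to a
probability measure, then they are probability measures for all small `δ`: the test integral of
`f ≡ 1` is the total mass, which is `0` or `1` and tends to `1`. -/
theorem ntb_eventually_isProbabilityMeasure {Ωδ : ℝ → Type*} [∀ δ, MeasurableSpace (Ωδ δ)]
    {X : Type*} [TopologicalSpace X] [MeasurableSpace X] {Y : ∀ δ, Ωδ δ → X}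
    {L : ∀ δ, Measure (Ωδ δ)} {μ : Measure X} [IsProbabilityMeasure μ]
    (hconv : TendstoLaw Y L id μ) (hL : ∀ δ, IsProbabilityMeasure (L δ) ∨ L δ = 0) :
    ∀ᶠ δ in 𝓝[>] (0 : ℝ), IsProbabilityMeasure (L δ) := by
  have h1 := hconv (1 : X →ᵇ ℝ)
  simp only [BoundedContinuousFunction.coe_one, Pi.one_apply, integral_const, smul_eq_mul,
    mul_one, probReal_univ] at h1
  filter_upwards [h1.eventually (lt_mem_nhds (show (1 : ℝ) / 2 < 1 by norm_num))] with δ hδ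
  rcases hL δ with h | h
  · exact h
  · exfalso
    rw [h, measureReal_zero_apply] at hδ
    linarith

/-- **Portmanteau bound for an open set along `𝓝[>] 0`.** If the laws `L δ` pushed forward by
measurable maps `Y δ` converge in law to the probability measure `μ`, the `L δ` are probability
measures for small `δ`, and the push-forwards charge an OPEN set `G` at most `η` for small `δ`,
then `μ G ≤ η` (`μ G ≤ liminf_δ (L δ).map (Y δ) G`, portmanteau). -/
theorem ntb_measure_le_of_tendstoLaw {Ωδ : ℝ → Type*} [∀ δ, MeasurableSpace (Ωδ δ)]
    {X : Type*} [PseudoMetricSpace X] [MeasurableSpace X] [BorelSpace X]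
    {Y : ∀ δ, Ωδ δ → X} {L : ∀ δ, Measure (Ωδ δ)} {μ : Measure X} [hμ : IsProbabilityMeasure μ]
    (hconv : TendstoLaw Y L id μ) (hY : ∀ δ, Measurable (Y δ))
    (hprob : ∀ᶠ δ in 𝓝[>] (0 : ℝ), IsProbabilityMeasure (L δ)) {G : Set X} (hG : IsOpen G)
    {η : ℝ≥0∞} (hev : ∀ᶠ δ in 𝓝[>] (0 : ℝ), (L δ).map (Y δ) G ≤ η) : μ G ≤ η := by
  classical
  -- the push-forwards, modified into probability measures off the good set
  let ν : ℝ → ProbabilityMeasure X := fun δ =>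
    if h : IsProbabilityMeasure (L δ) then
      ⟨(L δ).map (Y δ), Measure.isProbabilityMeasure_map (hY δ).aemeasurable⟩
    else ⟨μ, hμ⟩
  have hν : ∀ᶠ δ in 𝓝[>] (0 : ℝ), (ν δ : Measure X) = (L δ).map (Y δ) := by
    filter_upwards [hprob] with δ h
    simp only [ν, dif_pos h, ProbabilityMeasure.coe_mk]
  have hlim : Tendsto ν (𝓝[>] (0 : ℝ)) (𝓝 ⟨μ, hμ⟩) := by
    refine ProbabilityMeasure.tendsto_iff_forall_integral_tendsto.2 fun f => ?_
    refine (hconv f).congr' ?_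
    filter_upwards [hν] with δ h
    rw [h, integral_map (hY δ).aemeasurable f.continuous.aestronglyMeasurable]
  calc μ G = ((⟨μ, hμ⟩ : ProbabilityMeasure X) : Measure X) G := rfl
    _ ≤ liminf (fun δ => (ν δ : Measure X) G) (𝓝[>] (0 : ℝ)) :=
        ProbabilityMeasure.le_liminf_measure_open_of_tendsto hlim hG
    _ ≤ η := by
        refine liminf_le_of_frequently_le' (Eventually.frequently ?_)
        filter_upwards [hν, hev] with δ h h'
        rw [h]
        exact h'

/-! ### The near-touch event is open in the curve space -/

/-- Every point of the trace of a curve class is within any `r > dist c₁ c₂` of some point of the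
trace of the other class (`Curve.infDist_range_le`). -/
theorem ntb_exists_mem_range_dist_lt {c₁ c₂ : CurveClass ℂ} {r : ℝ} (h : dist c₁ c₂ < r)
    {z : ℂ} (hz : z ∈ c₁.range) : ∃ w ∈ c₂.range, dist z w < r := by
  obtain ⟨γ₁, rfl⟩ := CurveClass.surjective_mk c₁
  obtain ⟨γ₂, rfl⟩ := CurveClass.surjective_mk c₂
  rw [CurveClass.dist_mk_mk] at h
  rw [CurveClass.range_mk] at hz ⊢
  obtain ⟨t, rfl⟩ := Curve.mem_range.1 hz
  exact (Metric.infDist_lt_iff γ₂.range_nonempty).1 ((Curve.infDist_range_le γ₁ γ₂ t).trans_lt h)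

/-- **The near-touch event `G_ε` is open** in `CurveClass ℂ`: for sets `S, K ⊆ ℂ` and `ε`, the
set of curve classes whose trace is pointwise `ε`-close to `S` (a maximum of `infDist · S` over
the compact nonempty trace is attained) and has a point `ε`-close to a point of `K` is open,
since traces of nearby classes are uniformly close (`ntb_exists_mem_range_dist_lt`). -/
theorem ntb_isOpen_nearTouch (S K : Set ℂ) (ε : ℝ) :
    IsOpen {γ : CurveClass ℂ | (∀ z ∈ γ.range, Metric.infDist z S < ε) ∧
      ∃ z ∈ γ.range, ∃ k ∈ K, dist z k < ε} := by
  rw [setOf_and]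
  refine IsOpen.inter ?_ ?_
  · refine Metric.isOpen_iff.2 fun γ₀ hγ₀ => ?_
    -- the supremum of `infDist · S` over the compact nonempty trace is attained
    obtain ⟨z₀, hz₀, hmax⟩ := γ₀.isCompact_range.exists_isMaxOn γ₀.range_nonempty
      (Metric.continuous_infDist_pt S).continuousOn
    have hM : Metric.infDist z₀ S < ε := hγ₀ z₀ hz₀
    refine ⟨ε - Metric.infDist z₀ S, sub_pos.2 hM, fun γ hγ z hz => ?_⟩
    rw [Metric.mem_ball] at hγ
    obtain ⟨w, hw, hzw⟩ := ntb_exists_mem_range_dist_lt hγ hz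
    have hwS : Metric.infDist w S ≤ Metric.infDist z₀ S := isMaxOn_iff.1 hmax w hw
    calc Metric.infDist z S ≤ Metric.infDist w S + dist z w := Metric.infDist_le_infDist_add_dist
      _ < Metric.infDist z₀ S + (ε - Metric.infDist z₀ S) := add_lt_add_of_le_of_lt hwS hzw
      _ = ε := add_sub_cancel _ _
  · refine Metric.isOpen_iff.2 fun γ₀ hγ₀ => ?_
    obtain ⟨z₀, hz₀, k, hk, hzk⟩ := hγ₀
    refine ⟨ε - dist z₀ k, sub_pos.2 hzk, fun γ hγ => ?_⟩
    rw [Metric.mem_ball, dist_comm] at hγ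
    obtain ⟨w, hw, hzw⟩ := ntb_exists_mem_range_dist_lt hγ hz₀
    refine ⟨w, hw, k, hk, ?_⟩
    have htri := dist_triangle w z₀ k
    rw [dist_comm w z₀] at htri
    linarith

/-! ### The stub -/

/-- **Stub 3b (passage glue, provable now): near-touch estimate ⇒ NoTouch.** Given common
endpoint approximations (stub C, used with `D' := D` to get one approximation per domain), a fast
window schedule with window-limit family `P`, `P` chordal, and the near-touch estimate of stub 3a
for this schedule: `P D`-almost no curve stays in `cl D'` while touching `cl (D ∖ D')`. Proof:
`G_ε` is OPEN in `CurveClass ℂ` (ranges are compact; every point of one trace is within the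
reparametrisation distance of the other trace, `ntb_isOpen_nearTouch`), it contains the NoTouch
event, and the window laws are probability measures for small `δ` (their total mass is `0` or `1`
and tends to `1`), so portmanteau (`ProbabilityMeasure.le_liminf_measure_open_of_tendsto` along
`𝓝[>] 0`) gives `P D (NoTouch event) ≤ P D (G_ε) ≤ liminf ν_δ (G_ε) ≤ η` for every `η > 0`. -/
theorem stub_noTouchOfNearTouchEstimate :
    (∀ D D' : Literature.Probability.RandomPlanarGeometry.DobrushinDomain, D.IsHullSubdomain D' → ∃ a b : ℝ → Literature.Probability.LatticeModels.HexVertex, Literature.Probability.RandomPlanarGeometry.SAW.IsEmbEndpointApprox Literature.Probability.LatticeModels.hexGraph Literature.Probability.LatticeModels.hexCenter D a b ∧ Literature.Probability.RandomPlanarGeometry.SAW.IsEmbEndpointApprox Literature.Probability.LatticeModels.hexGraph Literature.Probability.LatticeModels.hexCenter D' a b) → ∀ (m x : ℝ → ℝ) (P : Literature.Probability.RandomPlanarGeometry.ChordalFamily), (Filter.Tendsto (fun δ => m δ * δ) (nhdsWithin 0 (Set.Ioi 0)) (nhds 0) ∧ Filter.Tendsto (fun δ => m δ / Real.log δ⁻¹)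 (nhdsWithin 0 (Set.Ioi 0)) Filter.atTop ∧ ∀ (D : Literature.Probability.RandomPlanarGeometry.DobrushinDomain) (a b : ℝ → Literature.Probability.LatticeModels.HexVertex), Literature.Probability.RandomPlanarGeometry.SAW.IsEmbEndpointApprox Literature.Probability.LatticeModels.hexGraph Literature.Probability.LatticeModels.hexCenter D a b → Literature.Probability.RandomPlanarGeometry.TendstoLaw (fun δ (γ : Literature.Probability.RandomPlanarGeometry.SAW.HexDomainSAW D.carrier δ (a δ) (b δ)) => γ.curve) (fun δ => Summit.CriticalPhenomena.SAWScalingLimit.Theorems.SAWMassiveIsingTilt.tiltLaw D.carrier δ (x δ) ((Real.sqrt 3)⁻¹ - m δ * δ) (a δ) (b δ)) id (P D)) → P.IsChordal → (∀ (D D' : Literature.Probability.RandomPlanarGeometry.DobrushinDomain), D.IsHullSubdomain D' → ∀ (a b : ℝ → Literature.Probability.LatticeModels.HexVertex), Literature.Probability.RandomPlanarGeometry.SAW.IsEmbEndpointApprox Literature.Probability.LatticeModels.hexGraph Literature.Probability.LatticeModels.hexCenter D a b → ∀ η : ℝ, 0 < η → ∃ ε : ℝ, 0 < ε ∧ ∀ᶠ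 δ in nhdsWithin 0 (Set.Ioi 0), (MeasureTheory.Measure.map (fun γ : Literature.Probability.RandomPlanarGeometry.SAW.HexDomainSAW D.carrier δ (a δ) (b δ) => γ.curve) (Summit.CriticalPhenomena.SAWScalingLimit.Theorems.SAWMassiveIsingTilt.tiltLaw D.carrier δ (x δ) ((Real.sqrt 3)⁻¹ - m δ * δ) (a δ) (b δ))) {γ : Literature.Probability.RandomPlanarGeometry.CurveClass ℂ | (∀ z ∈ γ.range, Metric.infDist z (closure D'.carrier) < ε) ∧ ∃ z ∈ γ.range, ∃ k ∈ closure (D.carrier \ D'.carrier), dist z k < ε} ≤ ENNReal.ofReal η) → (∀ D D' : Literature.Probability.RandomPlanarGeometry.DobrushinDomain, D.IsHullSubdomain D' → P D {γ | γ.range ⊆ closure D'.carrier ∧ (γ.range ∩ closure (D.carrier \ D'.carrier)).Nonempty} = 0) := by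
  intro hC m x P hW hP hNT D D' hDD'
  obtain ⟨a, b, hab, -⟩ := hC D D' hDD'
  haveI : IsProbabilityMeasure (P D) := (hP D).1
  have hconv := hW.2.2 D a b hab
  -- the window laws are probability measures for small `δ`
  have hprob : ∀ᶠ δ in 𝓝[>] (0 : ℝ), IsProbabilityMeasure
      (tiltLaw D.carrier δ (x δ) ((Real.sqrt 3)⁻¹ - m δ * δ) (a δ) (b δ)) :=
    ntb_eventually_isProbabilityMeasure hconv fun δ =>
      ntb_isProbabilityMeasure_tiltLaw_or_eq_zero _ _ _ _ _ _
  -- it suffices to bound the NoTouch event by every `η > 0`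
  refine le_antisymm (ENNReal.le_of_forall_pos_le_add fun η hη _ => ?_) bot_le
  rw [zero_add]
  obtain ⟨ε, hε, hev⟩ := hNT D D' hDD' a b hab η (NNReal.coe_pos.2 hη)
  calc P D {γ | γ.range ⊆ closure D'.carrier ∧
          (γ.range ∩ closure (D.carrier \ D'.carrier)).Nonempty}
      ≤ P D {γ : CurveClass ℂ | (∀ z ∈ γ.range, Metric.infDist z (closure D'.carrier) < ε) ∧
          ∃ z ∈ γ.range, ∃ k ∈ closure (D.carrier \ D'.carrier), dist z k < ε} := by
        -- the NoTouch event lies in `G_ε`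
        refine measure_mono fun γ hγ => ⟨fun z hz => ?_, ?_⟩
        · rw [Metric.infDist_zero_of_mem (hγ.1 hz)]
          exact hε
        · obtain ⟨z, hz, hzK⟩ := hγ.2
          exact ⟨z, hz, z, hzK, by rw [dist_self]; exact hε⟩
    _ ≤ ENNReal.ofReal η :=
        ntb_measure_le_of_tendstoLaw hconv (fun δ => SAW.EmbDomainSAW.measurable_of_top _) hprob
          (ntb_isOpen_nearTouch _ _ ε) hev
    _ = (η : ℝ≥0∞) := ENNReal.ofReal_coe_nnreal

end Summit.CriticalPhenomena.SAWScalingLimit.Theorems.MassiveWindowSLE.Birth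

end
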